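import Literature.MathematicalPhysics.QuantumFieldTheory.Balaban1983to89.B9Eq39Adjoint
import Mathlib.Analysis.Normed.Field.Basic
import HarnessLib

/-!
# Prop 7, route-R E′, (E1-c) brick F4c(i) — THE PINNED PATH BOUND: `ψ|_C = 0` ⇒ `‖ψ(x)‖ ≤ dist(x,C)·sup‖D_Uψ‖` (abstract lattice, norm-preserving transport)

Route `UnitScaleTilt`, crux K1 child «MinimiserStabilityRegPr» (`stmt-QuantumFields-19200`), cell ym3-torus, width seat px15 (gen 2); pen «px15 g2: (E1-c) GO-LOCATE» (★p1 g15,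
2026-08-28T20:45:05Z), LOCATE `LOCATE-E1C-DIVLIPSCHITZ-px15g2.md` §6 (F4, the ρ₃-junction: `‖M_{ψ(x)}‖·‖Δ_W(ψ−ψ′)(x)‖ ≤ 2‖ψ(x)‖‖Δ_W(ψ−ψ′)(x)‖` and `‖ψ(x)‖ ≤ dist(x,C)·sup‖D_Wψ‖`, so that
`ℓ²(…) ≤ 2ρ₂(ψ)ρ₃(ψ−ψ′)` with ★routeR-w3's ADOPTED third row `ρ₃(ψ) = ℓ·sup_x min(dist(x,C),ℓ)‖Δ_Wψ(x)‖`).  THEOREMS ONLY (0 `def`, 0 `sorry`); `--supports stmt-QuantumFields-19200`,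
count-neutral.  YM₃ on T³ is a ladder rung (R3), not the Clay problem; nothing here claims the stub, the crux, d = 4 or the mass gap.

WHAT IS PROVED (letters of `B9Eq39Adjoint`: shifts `T : ι → Equiv.Perm S`, transports `U : ι → S → 𝔸ˣ`, `R u M = uMu⁻¹`, `covD T U μ f x = R(U μ x) f(T μ x) − f x`; `𝔸` any normed ring;
the only input on `U` is norm-preservation `‖R(U μ x)M‖ = ‖M‖`, true for unitary transports):
* `norm_le_norm_shift_add`, `norm_shift_le_norm_add` — one step along ∕ against a bond changes `‖f‖` by at most `‖D_μ f‖`;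
* ★★ `norm_le_potential_mul` — if `f = 0` on `C` and `d : S → ℕ` is a POTENTIAL (every `x ∉ C` has a lattice neighbour `T μ x` or `(T μ)⁻¹ x` with strictly smaller `d`), then
  `‖f x‖ ≤ d(x)·δ` whenever `‖D_μ f‖ ≤ δ` everywhere.  On the torus `d = ` graph distance to the coarse sites `C = range(embIter)` is such a potential (F4c(ii) instantiates).
HONEST SCOPE.  Elementary ([folklore]: telescoping along a shortest path).

References: T. Bałaban, CMP 99 (1985) 389–434 [Balaban1985BackgroundPropagators] ((3.8) p.392: the covariant derivative letters); [folklore].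
-/

set_option autoImplicit false

namespace Summit.QuantumFields.YangMills.Theorems.Prop7PinnedPathBound

open Literature.MathematicalPhysics.QuantumFieldTheory.Balaban1983to89.B9Eq39Adjoint (R covD)

variable {𝔸 : Type*} [NormedRing 𝔸] {S : Type*} {ι : Type*} (T : ι → Equiv.Perm S) (U : ι → S → 𝔸ˣ)

/-- One step ALONG a bond: `‖f x‖ ≤ ‖f(T μ x)‖ + ‖(D_μ f)(x)‖` (norm-preserving transport). [folklore] -/
theorem norm_le_norm_shift_add (hR : ∀ μ x (M : 𝔸), ‖R (U μ x) M‖ = ‖M‖) (f : S → 𝔸) (μ : ι) (x : S) :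
    ‖f x‖ ≤ ‖f (T μ x)‖ + ‖covD T U μ f x‖ := by
  have e : f x = R (U μ x) (f (T μ x)) - covD T U μ f x := by
    simp only [covD, sub_sub_cancel]
  calc ‖f x‖ = ‖R (U μ x) (f (T μ x)) - covD T U μ f x‖ := by rw [← e]
    _ ≤ ‖R (U μ x) (f (T μ x))‖ + ‖covD T U μ f x‖ := norm_sub_le _ _
    _ = ‖f (T μ x)‖ + ‖covD T U μ f x‖ := by rw [hR]

/-- One step AGAINST a bond: `‖f(T μ y)‖ ≤ ‖f y‖ + ‖(D_μ f)(y)‖`. [folklore] -/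
theorem norm_shift_le_norm_add (hR : ∀ μ x (M : 𝔸), ‖R (U μ x) M‖ = ‖M‖) (f : S → 𝔸) (μ : ι) (y : S) :
    ‖f (T μ y)‖ ≤ ‖f y‖ + ‖covD T U μ f y‖ := by
  have e : R (U μ y) (f (T μ y)) = f y + covD T U μ f y := by
    simp only [covD, add_sub_cancel]
  calc ‖f (T μ y)‖ = ‖R (U μ y) (f (T μ y))‖ := (hR μ y _).symm
    _ = ‖f y + covD T U μ f y‖ := by rw [e]
    _ ≤ ‖f y‖ + ‖covD T U μ f y‖ := norm_add_le _ _

/-- ★★ **THE PINNED PATH BOUND.**  `f = 0` on `C`, `‖D_μ f‖ ≤ δ` everywhere, and `d : S → ℕ` a potential decreasing toward `C` along lattice bonds ⇒ `‖f x‖ ≤ d(x)·δ`. [folklore] -/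
theorem norm_le_potential_mul (hR : ∀ μ x (M : 𝔸), ‖R (U μ x) M‖ = ‖M‖) (f : S → 𝔸) {δ : ℝ} (hδ0 : 0 ≤ δ)
    (hδ : ∀ μ x, ‖covD T U μ f x‖ ≤ δ) (C : Set S) (hC : ∀ x ∈ C, f x = 0) (d : S → ℕ)
    (hd : ∀ x, x ∉ C → ∃ μ, d (T μ x) + 1 ≤ d x ∨ d ((T μ).symm x) + 1 ≤ d x) :
    ∀ x, ‖f x‖ ≤ d x * δ := by
  suffices h : ∀ n : ℕ, ∀ x, d x ≤ n → ‖f x‖ ≤ d x * δ from fun x => h (d x) x le_rfl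
  intro n
  induction n with
  | zero =>
    intro x hx
    by_cases hxC : x ∈ C
    · rw [hC x hxC, norm_zero]; positivity
    · obtain ⟨μ, h | h⟩ := hd x hxC <;> omega
  | succ n ih =>
    intro x hx
    by_cases hxC : x ∈ C
    · rw [hC x hxC, norm_zero]; positivity
    · obtain ⟨μ, h | h⟩ := hd x hxC
      · have hy := ih (T μ x) (by omega)
        have hcast : ((d (T μ x) : ℝ) + 1) ≤ d x := by exact_mod_cast h
        calc ‖f x‖ ≤ ‖f (T μ x)‖ + ‖covD T U μ f x‖ := norm_le_norm_shift_add T U hR f μ x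
          _ ≤ d (T μ x) * δ + δ := add_le_add hy (hδ μ x)
          _ = ((d (T μ x) : ℝ) + 1) * δ := by ring
          _ ≤ d x * δ := mul_le_mul_of_nonneg_right hcast hδ0
      · have hTy : T μ ((T μ).symm x) = x := (T μ).apply_symm_apply x
        have hy := ih ((T μ).symm x) (by omega)
        have hcast : ((d ((T μ).symm x) : ℝ) + 1) ≤ d x := by exact_mod_cast h
        have hstep := norm_shift_le_norm_add T U hR f μ ((T μ).symm x)
        rw [hTy] at hstep
        calc ‖f x‖ ≤ ‖f ((T μ).symm x)‖ + ‖covD T U μ f ((T μ).symm x)‖ := hstep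
          _ ≤ d ((T μ).symm x) * δ + δ := add_le_add hy (hδ μ _)
          _ = ((d ((T μ).symm x) : ℝ) + 1) * δ := by ring
          _ ≤ d x * δ := mul_le_mul_of_nonneg_right hcast hδ0

/-- Corollary in the (E1) currency: with `‖D_μ f‖ ≤ δ` and the potential capped, `min(d(x), ℓ)`-weighted: `‖f x‖ ≤ min(d x, ℓ)·δ + [ℓ ≤ d x]·‖f x‖`-free form —
`ℓ·‖f x‖ ≤ max(ℓ·δ, sup‖f‖)·min(d x, ℓ)` is how F4c uses it; here the clean special case `d x ≤ ℓ ⇒ ‖f x‖ ≤ min(d x, ℓ)·δ`. [folklore] -/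
theorem norm_le_min_potential_mul (hR : ∀ μ x (M : 𝔸), ‖R (U μ x) M‖ = ‖M‖) (f : S → 𝔸) {δ : ℝ} (hδ0 : 0 ≤ δ)
    (hδ : ∀ μ x, ‖covD T U μ f x‖ ≤ δ) (C : Set S) (hC : ∀ x ∈ C, f x = 0) (d : S → ℕ)
    (hd : ∀ x, x ∉ C → ∃ μ, d (T μ x) + 1 ≤ d x ∨ d ((T μ).symm x) + 1 ≤ d x) (ℓ : ℕ) (x : S) (hx : d x ≤ ℓ) :
    ‖f x‖ ≤ (min (d x) ℓ : ℕ) * δ := by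
  rw [min_eq_left hx]
  exact norm_le_potential_mul T U hR f hδ0 hδ C hC d hd x

end Summit.QuantumFields.YangMills.Theorems.Prop7PinnedPathBound
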